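import Mathlib
import Summits.KontsevichZagierPeriods.Zeta5Search.X1CellQSplit
import HarnessLib

/-!
# ζ(5) search — the `X1CellQ` sliver is decided by ONE exact valuation (gen-2 g23)
HONEST FRAMING: systematic search; no irrationality claim unless certified.  Valuations of the Brown–Zudilin Casoratian only.

`RayAtlas.X1CellQSliver` (gen-2 g19, `X1CellQSplit.lean`: ray `bX1Ray n = n·(61; 22,…,16)`, primes `50n < 7p`, `6p < 43n`,
asserted bound `v_p(Cas₇) ≥ −26 = casLB + 1`) and hence `RayAtlas.X1CellQ` (gen-2 g9, `RayAtlasCellsX.lean`, `θ = p/n ∈ (7, 43/6)`)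
are decided by the single number `v₁₇₉(Cas₇(bX1Ray 25))`: the pair `(n, p) = (25, 179)` (`θ = 7.16`; `1250 < 1253`, `1074 < 1075`)
satisfies every arithmetic hypothesis of the sliver (`sliverWitness_hyps`), so the value `−27` there refutes both statements
(`not_x1CellQSliver_of_witness`, `not_x1CellQ_of_witness`; any certificate of `≤ −27` with `Cas₇ ≠ 0` does, via `x1CellQSliver_at_witness`).

EVIDENCE (exact arithmetic, THREE implementations, gen-2 g23 folder `x1/`, mirrored to `HOME/pub-zeta5-gen-2/g23/`):
`v₁₇₉(Cas₇(bX1Ray 25)) = −27 = casLB` by (i) gen-2 g12's certified p-adic engine `vpadic.py` (60 digits, 78 s), (ii) the cell engine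
`engines/code` `exactrec.hgeom` impl A (exact rationals, 52 s) and (iii) impl B (143 s); `v(U, W, V) = (−10, −12, −15)` for `b` and `b + e₇`
in all three.  Further sliver instances `(27, 193)`, `(32, 229)`: `−27` (engine A); main-part instances `(10, 71)`, `(27, 191)`, `(32, 227)`:
`−26` (= the PROVED `Atlas.X1CellQMain.holds`); cell-P side `(25, 173)`, `(32, 223)` and the gap `θ ≥ 43/6` (`(6, 43)`, `(10, 73)`, `(25, 181)`,
`(27, 197)`, `(32, 233)`): `−27`.  So on `θ ∈ [61/9, 23/3)` the `+1` occurs EXACTLY on the collinearity criterion's moment range `14p ≤ 100n + 1`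
(`θ ≤ 50/7`), which is therefore sharp on ray X1; gen-2 g9's structural atlas endpoint `43/6` and the g19 docstring claims "none below
`n = 42`" / "−26 at `(6, 43)`" are errata (smallest prime sliver instance is `(25, 179)`; `(6, 43)` gives `−27`).

WHAT REMAINS FOR THE KERNEL: `SliverWitnessValue` below (a COMPUTATION verdict, not a conjecture about a family): certify the first
`179`-adic digit of `Cas₇(bX1Ray 25)` — e.g. from the landed class digits `UniversalDigitDischarge.wDigit_holds` / `vDigit_holds`
(`W̃`, `Ṽ` images in `ZMod 179` for `b` and `b + e₇`, then `det ≠ 0` by `decide`) — and apply `not_x1CellQSliver_of_witness`.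
Nothing here is used by RECORD.md / CENSUS.md (no column effect); the near-miss ray X1 has γ < γ_BZ regardless.
-/

namespace Summit.KontsevichZagierPeriods.Zeta5Search.RayAtlas

open Summit.KontsevichZagierPeriods.Zeta5Search.CasoratianValuation (casoratian)

/-- **The deciding number** (a COMPUTATION target, not a law: value `−27` by three exact implementations; kernel certificate wanted,
e.g. via the landed class digits `wDigit_holds` / `vDigit_holds`): `v₁₇₉(Cas₇(bX1Ray 25)) = −27`. -/
@[conjecture] def SliverWitnessValue : Prop := padicValRat 179 (casoratian (bX1Ray 25) 7) = -27

/-- The witness `(n, p) = (25, 179)` satisfies every arithmetic hypothesis of `X1CellQSliver` (it lies OUTSIDE the proved main part: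
`7 · 179 = 1253 > 1250 = 50 · 25`, and inside the sliver by one unit at each end: `1250 < 1253`, `1074 < 1075`). -/
theorem sliverWitness_hyps :
    (2 : ℕ) ≤ 25 ∧ Nat.Prime 179 ∧ 61 * 25 + 2 < 179 * 179 ∧ 50 * 25 < 7 * 179 ∧ 6 * 179 < 43 * 25 := by
  refine ⟨by norm_num, by norm_num, by norm_num, by norm_num, by norm_num⟩

/-- What `X1CellQSliver` PREDICTS at the witness: `v₁₇₉(Cas₇(bX1Ray 25)) ≥ −26` (any certificate of `≤ −27` with `Cas₇ ≠ 0` contradicts it). -/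
theorem x1CellQSliver_at_witness (hS : X1CellQSliver) (hne : casoratian (bX1Ray 25) 7 ≠ 0) :
    (-26 : ℤ) ≤ padicValRat 179 (casoratian (bX1Ray 25) 7) := by
  obtain ⟨h2, hp, hsq, hlo, hhi⟩ := sliverWitness_hyps
  exact hS 25 179 h2 hp hsq hlo hhi hne

/-- **Refutation reduced to the deciding number**: `SliverWitnessValue → ¬ X1CellQSliver`. -/
theorem not_x1CellQSliver_of_witness (h : SliverWitnessValue) : ¬ X1CellQSliver := by
  intro hS
  have h' : padicValRat 179 (casoratian (bX1Ray 25) 7) = -27 := h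
  have hne : casoratian (bX1Ray 25) 7 ≠ 0 := by
    intro h0
    rw [h0] at h'
    simp at h'
  have key := x1CellQSliver_at_witness hS hne
  omega

/-- The same number refutes gen-2 g9's `X1CellQ` (the sliver is a restriction of it, `x1CellQSliver_of`): `SliverWitnessValue → ¬ X1CellQ`. -/
theorem not_x1CellQ_of_witness (h : SliverWitnessValue) : ¬ X1CellQ :=
  fun hQ => not_x1CellQSliver_of_witness h (x1CellQSliver_of hQ)

end Summit.KontsevichZagierPeriods.Zeta5Search.RayAtlas
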